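import Literature.Computability.MetaComplexity.ResolutionProofs
import HarnessLib

/-!
# `k`-DNF resolution `R(k)` / `Res(k)` (Krajíček): lines, derivations, refutations, size

The proof systems `R(k)` ("resolution over `k`-DNFs", `Res(k)`, `k`-DNF resolution) were
introduced by Krajíček [Krajicek2001, Def. 1.1] as the fragments of DNF-resolution `R⁺ = DNF-R`
whose lines are `k`-DNFs, i.e. disjunctions of *terms* (conjunctions of literals) of size at most
`k` [KrajicekProofComplexity2019, §5.7]. `R(1)` is resolution. They are needed in the tree to
state the `Res(ε log n)` lower bounds for Nisan–Wigderson generator / random-CNF formulas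
(Razborov 2015, Alekhnovich 2011, Segerlind–Buss–Impagliazzo 2004) as named facts.

We formalise `R(k)` over G01's literals `Literal ν := ν × Bool` exactly in the style of the
tree's resolution system `Literature.Computability.MetaComplexity.IsResRefutation`
(`Resolution.lean`): a line is a DNF — a `Finset` of terms, a term being a `Finset (Literal ν)` —
together with the rule application that produced it, validity of a line sequence is a `Prop`,
and the size of a derivation is its number of lines.

## The rules (Ben-Sasson–Nordström's printed form of Krajíček's system)

We follow the rule list printed as [BenSassonNordstrom2009, Def. 2.1] ("`k`-DNF-resolution
inference rules"; `A, B, C` denote `k`-DNFs, `T, T'` terms of size `≤ k`, `a₁, …, a_{k'}`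
literals), with derivations from a CNF `F` starting by "axiom download" of clauses `C ∈ F`
[BenSassonNordstrom2009, Def. 2.2]:

* `k`-cut: `(a₁ ∧ ⋯ ∧ a_{k'}) ∨ B`, `¬a₁ ∨ ⋯ ∨ ¬a_{k'} ∨ C ⊢ B ∨ C` (`1 ≤ k' ≤ k`);
* `∧`-introduction: `A ∨ T`, `A ∨ T' ⊢ A ∨ (T ∪ T')`, as long as `|T ∪ T'| ≤ k`;
* `∧`-elimination: `A ∨ T ⊢ A ∨ T'` for any `T' ⊆ T`;
* weakening: `A ⊢ A ∨ B` for any `k`-DNF `B`;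
* axiom: a clause of the refuted CNF, read as a 1-DNF (its literals as singleton terms).

"For brevity we denote by `R(k)` the proof system of `k`-DNF resolution. […] Notice that the
system `R(1)` is the usual resolution proof system." (loc. cit.). A refutation is a derivation of
the empty DNF `0`; "The length of a `R(k)`-derivation `π` is the number of axiom downloads and
inference steps in it" [BenSassonNordstrom2009, Def. 2.3] — here `resKSize π = π.length`
("The size of a `Res(k)` refutation is the number of `k`-disjunctions in it",
[AtseriasBonet2004, §2]).

Printed variants, all mutually simulating each other with at most a factor-`O(k)` change of
length (we record them, we do not formalise the simulations): Krajíček's original `DNF-R`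
[Krajicek2001, Def. 1.1; KrajicekProofComplexity2019, §5.7] has the cut in the form
`C ∪ {⋀ⱼ ℓⱼ}, D ∪ {¬ℓ'₁, …, ¬ℓ'ₜ} ⊢ C ∪ D` for `t ≥ 1` and the `ℓ'ᵢ` *among* the `ℓⱼ`, the
`∧`-introduction with two different side formulas, and neither weakening nor `∧`-elimination;
[AtseriasBonet2004, §2] has weakening, `∧`-introduction, cut and the axioms `l ∨ ¬l`;
[Segerlind2007, §3.1] and [SegerlindBussImpagliazzo2004, §2] use the resolution rules
(cut on one literal, subsumption) plus a `j`-ary `∧`-introduction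
`x₁ ∨ C, …, x_j ∨ C ⊢ (⋀ᵢ xᵢ) ∨ C` and `∧`-elimination.

## What is proved here

* `IsResKDerivation.take` (prefixes), `IsResKDerivation.mono` (`R(k) ⊆ R(k')` for `k ≤ k'`),
  `minResKRefutationSize_anti`;
* soundness: `dnfEval_of_isResKDerivation`, `IsResKRefutation.not_satisfiable`
  [KrajicekProofComplexity2019, L. 5.7.1, "if" direction];
* `R(1)` **is** resolution, with equal sizes: every resolution refutation (`IsResRefutation`,
  with the weakening rule) is, line by line, an `R(k)`-refutation for every `k ≥ 1`
  (`IsResRefutation.toResK`), and every `R(1)`-refutation translates line by line into a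
  resolution refutation of the same length (`IsResKRefutation.exists_isResRefutation`); hence
  `minResKRefutationSize 1 φ = minResRefutationSize φ` (`minResKRefutationSize_one`) and
  `minResKRefutationSize k φ ≤ minResRefutationSize φ` [BenSassonNordstrom2009, §2.2 ("the
  system `R(1)` is the usual resolution proof system"); Krajicek2001, §1 ("the size of
  `R(1)`-proofs is just the size of `R`-proofs")];
* completeness for `k ≥ 1` (`exists_isResKRefutation_of_not_satisfiable`, from the tree's
  completeness of resolution) and `minResKRefutationSize_lt_top_iff`
  [KrajicekProofComplexity2019, L. 5.7.1].

Not vendored: the simulation of `R(k)` by depth-2 Frege systems (folklore, e.g. Bonacina 2017,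
§1.1.1: "for constant `k`, resolution over `k`-DNFs is even weaker than depth-2 Frege"); no
printed theorem with a locator in the tree's vocabulary (`textbookFrege`) was found —
Krajíček 2019, L. 5.7.2 is the different statement "`R` p-simulates `R*(log)`".

## Design notes

* Terms and DNFs are `Finset`s (as in all sources: "a term is specified as a set of literals …
  A DNF is a disjunction of terms, specified as a set of terms", Segerlind 2007, App.), so
  `A ∨ T` is `insert T A` and `B ∨ C` is `B ∪ C`; the side formulas `A, B, C` of a rule are
  existentially quantified (the literal reading of the printed rules; the strongest conclusion,
  e.g. `B = line ∖ {T}`, is one admissible choice and the others are its weakenings).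
* The empty term is allowed in lines (it is the constant `1`, Segerlind 2007, App.; it never
  occurs in a translated resolution refutation and lines containing it are never needed); the cut
  term must be nonempty (`t ≥ 1` in Krajíček's rule, `k'`-fold conjunction in Def. 2.1).
* The bound `k` is imposed on every line (`IsKDNF k`), which subsumes the side conditions
  `|T ∪ T'| ≤ k`, `k' ≤ k` of Def. 2.1.
* `ResKRule.premises` exposes the premise DAG so that the generic measures of `Resolution.lean`
  (`dagDepth`, tree-likeness) can be reused verbatim later; they are not needed now.
-/

namespace Literature.Computability.MetaComplexity

open _root_.Computability Complexity

variable {ν : Type*}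

/-! ### Terms, DNF lines and their semantics -/

/-- A term (a finite set of literals, read conjunctively) is true under `σ` iff all its literals
are; the empty term is the constant `1`. [Segerlind 2007, App. (terms as sets of literals,
`1` = the empty set)] [cite: Segerlind2007, Appendix (terms)] -/
def termEval (σ : ν → Bool) (T : Finset (Literal ν)) : Prop :=
  ∀ l ∈ T, l.eval σ = true

/-- A DNF (a finite set of terms, read disjunctively) is true under `σ` iff some term is; the
empty DNF `0` is false. [Ben-Sasson–Nordström 2009, §2.1–2.2 (the empty DNF `0`)]
[cite: BenSassonNordstrom2009, Def. 2.2 (the empty DNF, denoted 0)] -/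
def dnfEval (σ : ν → Bool) (D : Finset (Finset (Literal ν))) : Prop :=
  ∃ T ∈ D, termEval σ T

/-- `D` is a `k`-DNF: every term of `D` has at most `k` literals.
[Krajíček 2001, Def. 1.1; Ben-Sasson–Nordström 2009, §2] [cite: Krajicek2001, Def. 1.1 (R(k))] -/
def IsKDNF (k : ℕ) (D : Finset (Finset (Literal ν))) : Prop :=
  ∀ T ∈ D, T.card ≤ k

/-- The union of all literals occurring in (the terms of) a DNF; for a 1-DNF without the empty
term this is the clause it denotes. [Ben-Sasson–Nordström 2009, §2.2 ("`R(1)` is the usual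
resolution proof system")] [folklore] -/
def dnfLits [DecidableEq ν] (D : Finset (Finset (Literal ν))) : Finset (Literal ν) :=
  D.biUnion id

/-- A clause (finite set of literals) read as a 1-DNF: its literals become singleton terms. This
is how the clauses of the refuted CNF enter an `R(k)`-derivation ("axiom download").
[Ben-Sasson–Nordström 2009, Def. 2.2 (Axiom Download)] [cite: BenSassonNordstrom2009, Def. 2.2] -/
def dnfOfClause [DecidableEq ν] (C : Finset (Literal ν)) : Finset (Finset (Literal ν)) :=
  C.image fun a => {a}

/-- The 1-DNF `¬a₁ ∨ ⋯ ∨ ¬a_{k'}` of the negated literals of a term `T = a₁ ∧ ⋯ ∧ a_{k'}` (the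
second premise of the `k`-cut rule, minus its side formula).
[Ben-Sasson–Nordström 2009, Def. 2.1 (k-cut)] [cite: BenSassonNordstrom2009, Def. 2.1] -/
def negTerm [DecidableEq ν] (T : Finset (Literal ν)) : Finset (Finset (Literal ν)) :=
  T.image fun a => {a.negate}

/-! ### Rules, lines, derivations, refutations, size -/

/-- The justification of a line of an `R(k)`-derivation: an initial clause of the refuted CNF
(axiom download), a `k`-cut of earlier lines `i` (containing the cut term) and `j` (containing
its negated literals), an `∧`-introduction from earlier lines `i, j`, an `∧`-elimination from
earlier line `i`, or a weakening of earlier line `i`. Indices refer to positions in the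
derivation. [Ben-Sasson–Nordström 2009, Def. 2.1–2.2; Krajíček 2001, Def. 1.1]
[cite: BenSassonNordstrom2009, Def. 2.1] -/
inductive ResKRule
  /-- an initial clause of the refuted CNF (axiom download) -/
  | initial : ResKRule
  /-- `k`-cut of lines `i` (`B ∨ ⋀ T`) and `j` (`C ∨ ⋁ ¬T`) -/
  | cut (i j : ℕ) : ResKRule
  /-- `∧`-introduction from lines `i` (`A ∨ T`) and `j` (`A ∨ T'`) -/
  | andIntro (i j : ℕ) : ResKRule
  /-- `∧`-elimination from line `i` -/
  | andElim (i : ℕ) : ResKRule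
  /-- weakening of line `i` -/
  | weaken (i : ℕ) : ResKRule
  deriving DecidableEq, Repr

/-- The premise indices of a rule application. [Ben-Sasson–Nordström 2009, Def. 2.1] [folklore] -/
def ResKRule.premises : ResKRule → List ℕ
  | .initial => []
  | .cut i j => [i, j]
  | .andIntro i j => [i, j]
  | .andElim i => [i]
  | .weaken i => [i]

/-- A line of an `R(k)`-derivation: a DNF (finite set of terms) with its justification.
[Ben-Sasson–Nordström 2009, Def. 2.1–2.2; Cook–Reckhow 1979, §1 (proofs as annotated
sequences)] [cite: BenSassonNordstrom2009, Def. 2.2] -/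
structure ResKLine (ν : Type*) where
  /-- the DNF derived at this line -/
  dnf : Finset (Finset (Literal ν))
  /-- the rule application justifying it -/
  rule : ResKRule

/-- The premise indices of a line. [Ben-Sasson–Nordström 2009, Def. 2.1] [folklore] -/
def ResKLine.premises (l : ResKLine ν) : List ℕ :=
  l.rule.premises

variable [DecidableEq ν]

/-- `r.Justifies φ prev D`: the rule application `r` derives the DNF `D` from the earlier lines
`prev` (and the CNF `φ`), literally as printed in [BenSassonNordstrom2009, Def. 2.1–2.2]:
* `initial`: `D` is a clause of `φ` read as a 1-DNF;
* `cut i j`: for some DNFs `B, C` and a nonempty term `T`, line `i` is `B ∨ T`, line `j` is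
  `C ∨ ¬a₁ ∨ ⋯ ∨ ¬a_{k'}` where `T = {a₁, …, a_{k'}}`, and `D = B ∨ C`;
* `andIntro i j`: line `i` is `A ∨ T`, line `j` is `A ∨ T'`, and `D = A ∨ (T ∪ T')`;
* `andElim i`: line `i` is `A ∨ T` and `D = A ∨ T'` for some `T' ⊆ T`;
* `weaken i`: line `i` is a subset of `D` (`A ⊢ A ∨ B`).
The size bounds (`|T ∪ T'| ≤ k`, `k' ≤ k`) are imposed on whole lines by `IsValidResKLine`.
[Ben-Sasson–Nordström 2009, Def. 2.1 (k-cut, ∧-introduction, ∧-elimination, weakening),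
Def. 2.2 (axiom download); Krajíček 2019, §5.7 (`t ≥ 1` in the cut rule)]
[cite: BenSassonNordstrom2009, Def. 2.1] -/
def ResKRule.Justifies (φ : CNF ν) (prev : List (ResKLine ν)) (D : Finset (Finset (Literal ν))) :
    ResKRule → Prop
  | .initial => ∃ C ∈ φ.clauseFinsets, D = dnfOfClause C
  | .cut i j => ∃ hi : i < prev.length, ∃ hj : j < prev.length,
      ∃ (B C : Finset (Finset (Literal ν))) (T : Finset (Literal ν)), T.Nonempty ∧
        (prev[i]'hi).dnf = insert T B ∧ (prev[j]'hj).dnf = C ∪ negTerm T ∧ D = B ∪ C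
  | .andIntro i j => ∃ hi : i < prev.length, ∃ hj : j < prev.length,
      ∃ (A : Finset (Finset (Literal ν))) (T T' : Finset (Literal ν)),
        (prev[i]'hi).dnf = insert T A ∧ (prev[j]'hj).dnf = insert T' A ∧ D = insert (T ∪ T') A
  | .andElim i => ∃ hi : i < prev.length,
      ∃ (A : Finset (Finset (Literal ν))) (T T' : Finset (Literal ν)), T' ⊆ T ∧
        (prev[i]'hi).dnf = insert T A ∧ D = insert T' A
  | .weaken i => ∃ hi : i < prev.length, (prev[i]'hi).dnf ⊆ D

/-- Validity of a line `l` of an `R(k)`-derivation from `φ`, given the earlier lines `prev`: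
its DNF is a `k`-DNF and its rule application derives it from `prev`.
[Ben-Sasson–Nordström 2009, Def. 2.1–2.2; Krajíček 2001, Def. 1.1]
[cite: BenSassonNordstrom2009, Def. 2.1–2.2] -/
def IsValidResKLine (k : ℕ) (φ : CNF ν) (prev : List (ResKLine ν)) (l : ResKLine ν) : Prop :=
  IsKDNF k l.dnf ∧ l.rule.Justifies φ prev l.dnf

/-- `π` is an `R(k)`-derivation from the CNF `φ`: every line is valid with respect to the lines
before it. [Ben-Sasson–Nordström 2009, Def. 2.2; Krajíček 2001, Def. 1.1]
[cite: BenSassonNordstrom2009, Def. 2.2] -/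
def IsResKDerivation (k : ℕ) (φ : CNF ν) (π : List (ResKLine ν)) : Prop :=
  ∀ m (hm : m < π.length), IsValidResKLine k φ (π.take m) (π[m]'hm)

/-- `π` is an `R(k)`-refutation of `φ`: an `R(k)`-derivation from `φ` containing the empty DNF
`0`. [Ben-Sasson–Nordström 2009, Def. 2.2 (refutation = derivation of the empty DNF);
Krajíček 2019, §5.7] [cite: BenSassonNordstrom2009, Def. 2.2] -/
def IsResKRefutation (k : ℕ) (φ : CNF ν) (π : List (ResKLine ν)) : Prop :=
  IsResKDerivation k φ π ∧ ∃ l ∈ π, l.dnf = ∅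

omit [DecidableEq ν] in
/-- The size (length) of an `R(k)`-derivation: its number of lines ("the number of axiom
downloads and inference steps", "the number of `k`-disjunctions in it").
[Ben-Sasson–Nordström 2009, Def. 2.3; Atserias–Bonet 2004, §2]
[cite: BenSassonNordstrom2009, Def. 2.3] -/
def resKSize (π : List (ResKLine ν)) : ℕ :=
  π.length

/-- The minimal size of an `R(k)`-refutation of `φ`, in `ℕ∞` (`⊤` iff there is none), the
quantity `L_{R(k)}(F ⊢ 0)`. [Ben-Sasson–Nordström 2009, Def. 2.3 (`L_{R(k)}(F ⊢ 0)`)]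
[cite: BenSassonNordstrom2009, Def. 2.3] -/
noncomputable def minResKRefutationSize (k : ℕ) (φ : CNF ν) : ℕ∞ :=
  ⨅ (π : List (ResKLine ν)) (_ : IsResKRefutation k φ π), (π.length : ℕ∞)

/-! ### Elementary API: terms, clauses as 1-DNFs -/

omit [DecidableEq ν] in
/-- Unfolding `resKSize`. [folklore] -/
@[simp] theorem resKSize_eq_length (π : List (ResKLine ν)) : resKSize π = π.length := rfl

omit [DecidableEq ν] in
/-- A singleton term is true iff its literal is. [folklore] -/
@[simp] theorem termEval_singleton (σ : ν → Bool) (a : Literal ν) :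
    termEval σ {a} ↔ a.eval σ = true := by
  simp [termEval]

omit [DecidableEq ν] in
/-- A `k`-DNF is a `k'`-DNF for `k ≤ k'`. [folklore] -/
theorem IsKDNF.mono {k k' : ℕ} {D : Finset (Finset (Literal ν))} (h : IsKDNF k D)
    (hk : k ≤ k') : IsKDNF k' D :=
  fun T hT => (h T hT).trans hk

/-- Membership in `dnfOfClause`. [folklore] -/
@[simp] theorem mem_dnfOfClause {C : Finset (Literal ν)} {T : Finset (Literal ν)} :
    T ∈ dnfOfClause C ↔ ∃ a ∈ C, {a} = T :=
  Finset.mem_image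

/-- Membership in `negTerm`. [folklore] -/
@[simp] theorem mem_negTerm {T S : Finset (Literal ν)} :
    S ∈ negTerm T ↔ ∃ a ∈ T, {a.negate} = S :=
  Finset.mem_image

/-- Membership in `dnfLits`. [folklore] -/
@[simp] theorem mem_dnfLits {D : Finset (Finset (Literal ν))} {a : Literal ν} :
    a ∈ dnfLits D ↔ ∃ T ∈ D, a ∈ T := by
  simp [dnfLits]

/-- The empty clause is the empty DNF. [folklore] -/
@[simp] theorem dnfOfClause_empty : dnfOfClause (∅ : Finset (Literal ν)) = ∅ :=
  Finset.image_empty _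

/-- `dnfOfClause` commutes with `insert`. [folklore] -/
theorem dnfOfClause_insert (a : Literal ν) (C : Finset (Literal ν)) :
    dnfOfClause (insert a C) = insert {a} (dnfOfClause C) :=
  Finset.image_insert _ _ _

/-- `dnfOfClause` commutes with unions. [folklore] -/
theorem dnfOfClause_union (C D : Finset (Literal ν)) :
    dnfOfClause (C ∪ D) = dnfOfClause C ∪ dnfOfClause D :=
  Finset.image_union _ _

/-- `dnfOfClause` is monotone. [folklore] -/
theorem dnfOfClause_mono {C D : Finset (Literal ν)} (h : C ⊆ D) :
    dnfOfClause C ⊆ dnfOfClause D :=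
  Finset.image_subset_image h

/-- The 1-DNF of a clause never contains the empty term. [folklore] -/
theorem empty_notMem_dnfOfClause (C : Finset (Literal ν)) :
    (∅ : Finset (Literal ν)) ∉ dnfOfClause C := by
  simp

/-- The 1-DNF of a clause is a `k`-DNF for every `k ≥ 1`. [folklore] -/
theorem isKDNF_dnfOfClause {k : ℕ} (hk : 1 ≤ k) (C : Finset (Literal ν)) :
    IsKDNF k (dnfOfClause C) := by
  intro T hT
  obtain ⟨a, -, rfl⟩ := mem_dnfOfClause.1 hT
  simpa using hk

/-- The negated 1-DNF of a singleton term. [folklore] -/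
@[simp] theorem negTerm_singleton (a : Literal ν) : negTerm {a} = {{a.negate}} :=
  Finset.image_singleton _ _

/-- `dnfLits` of an extended DNF. [folklore] -/
theorem dnfLits_insert (T : Finset (Literal ν)) (D : Finset (Finset (Literal ν))) :
    dnfLits (insert T D) = T ∪ dnfLits D :=
  Finset.biUnion_insert

/-- `dnfLits` of a union. [folklore] -/
theorem dnfLits_union (D E : Finset (Finset (Literal ν))) :
    dnfLits (D ∪ E) = dnfLits D ∪ dnfLits E :=
  Finset.union_biUnion

/-- `dnfLits` of a one-term DNF. [folklore] -/
@[simp] theorem dnfLits_singleton (T : Finset (Literal ν)) : dnfLits {T} = T :=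
  Finset.singleton_biUnion

/-- `dnfLits` of the empty DNF. [folklore] -/
@[simp] theorem dnfLits_empty : dnfLits (∅ : Finset (Finset (Literal ν))) = ∅ :=
  Finset.biUnion_empty

/-- `dnfLits` is monotone. [folklore] -/
theorem dnfLits_mono {D E : Finset (Finset (Literal ν))} (h : D ⊆ E) : dnfLits D ⊆ dnfLits E :=
  Finset.biUnion_subset_biUnion_of_subset_left _ h

/-- The literals of the 1-DNF of a clause are the clause. [folklore] -/
@[simp] theorem dnfLits_dnfOfClause (C : Finset (Literal ν)) : dnfLits (dnfOfClause C) = C := by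
  ext a
  simp only [mem_dnfLits, mem_dnfOfClause]
  constructor
  · rintro ⟨T, ⟨b, hb, rfl⟩, hab⟩
    rwa [Finset.mem_singleton.1 hab]
  · intro ha
    exact ⟨{a}, ⟨a, ha, rfl⟩, Finset.mem_singleton_self a⟩

/-- The 1-DNF of a clause is true iff the clause is (`finsetClauseEval`). [folklore] -/
theorem dnfEval_dnfOfClause (σ : ν → Bool) (C : Finset (Literal ν)) :
    dnfEval σ (dnfOfClause C) ↔ finsetClauseEval σ C := by
  constructor
  · rintro ⟨T, hT, hTt⟩
    obtain ⟨a, ha, rfl⟩ := mem_dnfOfClause.1 hT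
    exact ⟨a, ha, (termEval_singleton σ a).1 hTt⟩
  · rintro ⟨a, ha, hat⟩
    exact ⟨{a}, mem_dnfOfClause.2 ⟨a, ha, rfl⟩, (termEval_singleton σ a).2 hat⟩

/-! ### Prefixes and monotonicity in `k` -/

/-- Prefixes of `R(k)`-derivations are `R(k)`-derivations. [Ben-Sasson–Nordström 2009, Def. 2.2]
[folklore] -/
theorem IsResKDerivation.take {k : ℕ} {φ : CNF ν} {π : List (ResKLine ν)}
    (h : IsResKDerivation k φ π) (n : ℕ) : IsResKDerivation k φ (π.take n) := by
  intro j hj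
  have hj' : j < n ∧ j < π.length := by simpa [List.length_take] using hj
  rw [List.take_take, min_eq_left hj'.1.le, List.getElem_take]
  exact h j hj'.2

/-- `R(k)`-derivations are `R(k')`-derivations for `k ≤ k'`. [Krajíček 2001, Def. 1.1]
[folklore] -/
theorem IsResKDerivation.mono {k k' : ℕ} {φ : CNF ν} {π : List (ResKLine ν)}
    (h : IsResKDerivation k φ π) (hk : k ≤ k') : IsResKDerivation k' φ π :=
  fun m hm => ⟨(h m hm).1.mono hk, (h m hm).2⟩

/-- `R(k)`-refutations are `R(k')`-refutations for `k ≤ k'`. [Krajíček 2001, Def. 1.1]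
[folklore] -/
theorem IsResKRefutation.mono {k k' : ℕ} {φ : CNF ν} {π : List (ResKLine ν)}
    (h : IsResKRefutation k φ π) (hk : k ≤ k') : IsResKRefutation k' φ π :=
  ⟨h.1.mono hk, h.2⟩

/-- A refutation bounds the minimal refutation size. [Ben-Sasson–Nordström 2009, Def. 2.3]
[folklore] -/
theorem minResKRefutationSize_le_length {k : ℕ} {φ : CNF ν} {π : List (ResKLine ν)}
    (h : IsResKRefutation k φ π) : minResKRefutationSize k φ ≤ π.length :=
  iInf₂_le π h

/-- The minimal `R(k)`-refutation size is antitone in `k`. [Krajíček 2001, Def. 1.1] [folklore] -/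
theorem minResKRefutationSize_anti {k k' : ℕ} (hk : k ≤ k') (φ : CNF ν) :
    minResKRefutationSize k' φ ≤ minResKRefutationSize k φ :=
  le_iInf₂ fun _ hπ => minResKRefutationSize_le_length (hπ.mono hk)

/-- A CNF has an `R(k)`-refutation iff its minimal `R(k)`-refutation size is finite. [folklore] -/
theorem minResKRefutationSize_lt_top_iff_exists (k : ℕ) (φ : CNF ν) :
    minResKRefutationSize k φ < ⊤ ↔ ∃ π : List (ResKLine ν), IsResKRefutation k φ π := by
  simp [minResKRefutationSize, iInf_lt_top]

/-- The empty line sequence is an `R(k)`-derivation (vacuously). [folklore] -/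
theorem isResKDerivation_nil (k : ℕ) (φ : CNF ν) : IsResKDerivation k φ ([] : List (ResKLine ν)) :=
  fun m hm => absurd hm (Nat.not_lt_zero m)

/-- Extending an `R(k)`-derivation by one line that is valid with respect to it yields an
`R(k)`-derivation. [Ben-Sasson–Nordström 2009, Def. 2.2] [folklore] -/
theorem IsResKDerivation.append_singleton {k : ℕ} {φ : CNF ν} {π : List (ResKLine ν)}
    (h : IsResKDerivation k φ π) {l : ResKLine ν} (hl : IsValidResKLine k φ π l) :
    IsResKDerivation k φ (π ++ [l]) := by
  intro m hm
  rw [List.length_append, List.length_singleton] at hm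
  rcases (Nat.lt_succ_iff.1 hm).lt_or_eq with hm' | rfl
  · rw [List.take_append_of_le_length hm'.le, List.getElem_append_left hm']
    exact h m hm'
  · rw [List.take_left' rfl, List.getElem_append_right le_rfl]
    simpa using hl

/-! ### Soundness -/

/-- One-step soundness of the rules of `R(k)`: if `σ` satisfies `φ` and every earlier line, it
satisfies any line justified from them (cut: if the cut term `T` of line `i` is true then no
negated literal of `T` in line `j` is; `∧`-introduction: if neither premise is satisfied inside
the common side formula then both `T` and `T'` are true; `∧`-elimination and weakening are
trivial; initial clauses are clauses of `φ`). [Krajíček 2019, L. 5.7.1 ("if" direction);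
Krajíček 2019, §5.1 (soundness of a rule)] [cite: KrajicekProofComplexity2019, Lemma 5.7.1] -/
theorem dnfEval_of_justifies {φ : CNF ν} {prev : List (ResKLine ν)}
    {D : Finset (Finset (Literal ν))} {r : ResKRule} (hr : r.Justifies φ prev D) {σ : ν → Bool}
    (hσ : φ.eval σ = true) (hprev : ∀ i (hi : i < prev.length), dnfEval σ (prev[i]'hi).dnf) :
    dnfEval σ D := by
  cases r with
  | initial =>
    obtain ⟨C, hC, rfl⟩ := hr
    obtain ⟨c, hc, rfl⟩ := List.mem_map.1 hC
    obtain ⟨l, hl, hlt⟩ := List.any_eq_true.1 ((CNF.eval_eq_true_iff φ σ).1 hσ c hc)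
    exact (dnfEval_dnfOfClause σ _).2 ⟨l, List.mem_toFinset.2 hl, hlt⟩
  | cut i j =>
    obtain ⟨hi, hj, B, C, T, -, hBi, hCj, rfl⟩ := hr
    have h1 := hprev i hi
    have h2 := hprev j hj
    rw [hBi] at h1
    rw [hCj] at h2
    obtain ⟨S, hS, hSt⟩ := h1
    rcases Finset.mem_insert.1 hS with rfl | hSB
    · obtain ⟨S', hS', hS't⟩ := h2
      rcases Finset.mem_union.1 hS' with hS'C | hS'n
      · exact ⟨S', Finset.mem_union_right _ hS'C, hS't⟩
      · obtain ⟨a, haT, rfl⟩ := mem_negTerm.1 hS'n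
        have ha := hSt a haT
        have hna := hS't a.negate (Finset.mem_singleton_self _)
        rw [Literal.eval_negate, ha] at hna
        simp at hna
    · exact ⟨S, Finset.mem_union_left _ hSB, hSt⟩
  | andIntro i j =>
    obtain ⟨hi, hj, A, T, T', hAi, hAj, rfl⟩ := hr
    have h1 := hprev i hi
    have h2 := hprev j hj
    rw [hAi] at h1
    rw [hAj] at h2
    obtain ⟨S, hS, hSt⟩ := h1
    rcases Finset.mem_insert.1 hS with rfl | hSA
    · obtain ⟨S', hS', hS't⟩ := h2
      rcases Finset.mem_insert.1 hS' with rfl | hS'A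
      · refine ⟨S ∪ S', Finset.mem_insert_self _ _, fun l hl => ?_⟩
        rcases Finset.mem_union.1 hl with hl | hl
        exacts [hSt l hl, hS't l hl]
      · exact ⟨S', Finset.mem_insert_of_mem hS'A, hS't⟩
    · exact ⟨S, Finset.mem_insert_of_mem hSA, hSt⟩
  | andElim i =>
    obtain ⟨hi, A, T, T', hT'T, hAi, rfl⟩ := hr
    have h1 := hprev i hi
    rw [hAi] at h1
    obtain ⟨S, hS, hSt⟩ := h1
    rcases Finset.mem_insert.1 hS with rfl | hSA
    · exact ⟨T', Finset.mem_insert_self _ _, fun l hl => hSt l (hT'T hl)⟩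
    · exact ⟨S, Finset.mem_insert_of_mem hSA, hSt⟩
  | weaken i =>
    obtain ⟨hi, hsub⟩ := hr
    obtain ⟨S, hS, hSt⟩ := hprev i hi
    exact ⟨S, hsub hS, hSt⟩

/-- Line-wise soundness of `R(k)`: an assignment satisfying the CNF `φ` satisfies (the DNF of)
every line of an `R(k)`-derivation from `φ` (strong induction on the line index; premises of
line `m` lie in `π.take m`). [Krajíček 2019, L. 5.7.1 ("if" direction)]
[cite: KrajicekProofComplexity2019, Lemma 5.7.1] -/
theorem dnfEval_of_isResKDerivation {k : ℕ} {φ : CNF ν} {π : List (ResKLine ν)}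
    (hπ : IsResKDerivation k φ π) {σ : ν → Bool} (hσ : φ.eval σ = true) (m : ℕ)
    (hm : m < π.length) : dnfEval σ (π[m]'hm).dnf := by
  induction m using Nat.strong_induction_on with
  | _ m ih =>
    refine dnfEval_of_justifies (hπ m hm).2 hσ fun i hi => ?_
    have him : i < m := by
      rw [List.length_take] at hi
      exact (lt_min_iff.1 hi).1
    rw [List.getElem_take]
    exact ih i him (him.trans hm)

/-- **Soundness of `R(k)`**: a CNF with an `R(k)`-refutation is unsatisfiable (a satisfying
assignment would satisfy every line, but the empty DNF has no true term).
[Krajíček 2019, L. 5.7.1 ("A is unsatisfiable if … it has a DNF-R refutation")]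
[cite: KrajicekProofComplexity2019, Lemma 5.7.1] -/
theorem IsResKRefutation.not_satisfiable {k : ℕ} {φ : CNF ν} {π : List (ResKLine ν)}
    (h : IsResKRefutation k φ π) : ¬ φ.Satisfiable := by
  rintro ⟨σ, hσ⟩
  obtain ⟨hπ, l, hl, hle⟩ := h
  obtain ⟨m, hm, rfl⟩ := List.getElem_of_mem hl
  obtain ⟨T, hT, -⟩ := dnfEval_of_isResKDerivation hπ hσ m hm
  simp [hle] at hT

/-! ### Resolution is `R(1)`: resolution refutations are `R(k)`-refutations, `k ≥ 1` -/

omit [DecidableEq ν] in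
/-- The rule translation resolution → `R(k)`: initial ↦ initial, resolution on `v` ↦ cut on the
singleton term `{v}`, weakening ↦ weakening. [Ben-Sasson–Nordström 2009, §2.2 ("in resolution …
the cut rule reduces to the familiar resolution rule")] [cite: BenSassonNordstrom2009, §2.2] -/
def ResRule.toResK : ResRule ν → ResKRule
  | .initial => .initial
  | .resolve i j _ => .cut i j
  | .weaken i => .weaken i

/-- The line translation resolution → `R(k)`: the clause is read as a 1-DNF.
[Ben-Sasson–Nordström 2009, §2.2] [cite: BenSassonNordstrom2009, §2.2] -/
def ResLine.toResK (l : ResLine ν) : ResKLine ν :=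
  ⟨dnfOfClause l.clause, l.rule.toResK⟩

/-- The DNF of a translated line. [folklore] -/
@[simp] theorem ResLine.toResK_dnf (l : ResLine ν) : l.toResK.dnf = dnfOfClause l.clause := rfl

/-- A valid resolution line is, read as a 1-DNF, a valid `R(k)`-line (`k ≥ 1`) with respect to
the translated earlier lines: a resolution step `C ∨ v, D ∨ ¬v ⊢ (C ∖ v) ∪ (D ∖ ¬v)` is the
`k`-cut with `T = {v}`, `B = C ∖ v`, `C' = D ∖ ¬v`. [Ben-Sasson–Nordström 2009, §2.2;
Krajíček 2001, §1 ("the size of `R(1)`-proofs is just the size of `R`-proofs")]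
[cite: BenSassonNordstrom2009, §2.2] -/
theorem IsValidResLine.toResK {k : ℕ} (hk : 1 ≤ k) {φ : CNF ν} {prev : List (ResLine ν)}
    {l : ResLine ν} (h : IsValidResLine φ prev l) :
    IsValidResKLine k φ (prev.map ResLine.toResK) l.toResK := by
  refine ⟨isKDNF_dnfOfClause hk _, ?_⟩
  obtain ⟨E, r⟩ := l
  cases r with
  | initial =>
    exact ⟨E, h, rfl⟩
  | resolve i j v =>
    obtain ⟨hi, hj, hv, hnv, hE⟩ := h
    have hi' : i < (prev.map ResLine.toResK).length := by simpa using hi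
    have hj' : j < (prev.map ResLine.toResK).length := by simpa using hj
    refine ⟨hi', hj', dnfOfClause ((prev[i]'hi).clause.erase (v, true)),
      dnfOfClause ((prev[j]'hj).clause.erase (v, false)), {(v, true)},
      Finset.singleton_nonempty _, ?_, ?_, ?_⟩
    · rw [List.getElem_map, ResLine.toResK_dnf, ← dnfOfClause_insert, Finset.insert_erase hv]
    · rw [List.getElem_map, ResLine.toResK_dnf, negTerm_singleton, Finset.union_comm,
        ← Finset.insert_eq]
      change dnfOfClause _ = insert {(v, false)} _
      rw [← dnfOfClause_insert, Finset.insert_erase hnv]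
    · change E = _ at hE
      change dnfOfClause E = _
      rw [hE, dnfOfClause_union]
  | weaken i =>
    obtain ⟨hi, hsub⟩ := h
    have hi' : i < (prev.map ResLine.toResK).length := by simpa using hi
    refine ⟨hi', ?_⟩
    rw [List.getElem_map, ResLine.toResK_dnf]
    exact dnfOfClause_mono hsub

/-- A resolution derivation is, line by line, an `R(k)`-derivation for every `k ≥ 1`.
[Ben-Sasson–Nordström 2009, §2.2; Krajíček 2001, §1] [cite: BenSassonNordstrom2009, §2.2] -/
theorem IsResDerivation.toResK {k : ℕ} (hk : 1 ≤ k) {φ : CNF ν} {π : List (ResLine ν)}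
    (h : IsResDerivation φ π) : IsResKDerivation k φ (π.map ResLine.toResK) := by
  intro m hm
  have hm' : m < π.length := by simpa using hm
  rw [← List.map_take, List.getElem_map]
  exact (h m hm').toResK hk

/-- **Resolution refutations are `R(k)`-refutations** (`k ≥ 1`), of the same size.
[Ben-Sasson–Nordström 2009, §2.2 ("the system `R(1)` is the usual resolution proof system");
Krajíček 2001, §1] [cite: BenSassonNordstrom2009, §2.2] -/
theorem IsResRefutation.toResK {k : ℕ} (hk : 1 ≤ k) {φ : CNF ν} {π : List (ResLine ν)}
    (h : IsResRefutation φ π) : IsResKRefutation k φ (π.map ResLine.toResK) := by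
  obtain ⟨hd, l, hl, hle⟩ := h
  exact ⟨hd.toResK hk, l.toResK, List.mem_map.2 ⟨l, hl, rfl⟩, by simp [hle]⟩

/-- The minimal `R(k)`-refutation size is at most the minimal resolution-refutation size
(`k ≥ 1`). [Krajíček 2001, §1] [cite: Krajicek2001, §1 (size of R(1)-proofs)] -/
theorem minResKRefutationSize_le_minResRefutationSize {k : ℕ} (hk : 1 ≤ k) (φ : CNF ν) :
    minResKRefutationSize k φ ≤ minResRefutationSize φ :=
  le_iInf₂ fun π hπ => (minResKRefutationSize_le_length (hπ.toResK hk)).trans_eq (by simp)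

/-- **Completeness of `R(k)`** (`k ≥ 1`): an unsatisfiable CNF has an `R(k)`-refutation (from the
completeness of resolution, `exists_isResRefutation_of_not_satisfiable_holds`).
[Krajíček 2019, L. 5.7.1 ("only if" direction)] [cite: KrajicekProofComplexity2019, Lemma 5.7.1] -/
theorem exists_isResKRefutation_of_not_satisfiable {k : ℕ} (hk : 1 ≤ k) {φ : CNF ν}
    (h : ¬ φ.Satisfiable) : ∃ π : List (ResKLine ν), IsResKRefutation k φ π := by
  obtain ⟨π, hπ⟩ := exists_isResRefutation_of_not_satisfiable_holds (ν := ν) h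
  exact ⟨_, hπ.toResK hk⟩

/-- The minimal `R(k)`-refutation size (`k ≥ 1`) is finite iff the CNF is unsatisfiable
(soundness and completeness of `R(k)`). [Krajíček 2019, L. 5.7.1]
[cite: KrajicekProofComplexity2019, Lemma 5.7.1] -/
theorem minResKRefutationSize_lt_top_iff {k : ℕ} (hk : 1 ≤ k) (φ : CNF ν) :
    minResKRefutationSize k φ < ⊤ ↔ ¬ φ.Satisfiable := by
  rw [minResKRefutationSize_lt_top_iff_exists]
  exact ⟨fun ⟨π, hπ⟩ => hπ.not_satisfiable, exists_isResKRefutation_of_not_satisfiable hk⟩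

/-! ### `R(1)` is resolution: `R(1)`-refutations translate back, line by line -/

/-- One translation step `R(1)` → resolution. Given an `R(1)`-derivation prefix `π` (all lines
1-DNFs) already translated into a resolution derivation `π'` of the same length in which every
line of `π` not containing the empty term `1` has become the clause of its literals, a further
line `l` valid with respect to `π` translates into a resolution line valid with respect to `π'`
with the same property: an initial clause stays initial; a weakening becomes a weakening; an
`∧`-elimination or `∧`-introduction on terms of size `≤ 1` repeats (weakens) a premise; a cut on
`T = {a}` becomes the resolution step on the variable of `a` — or a weakening of one premise when
`a` or `¬a` survives in the conclusion. Lines containing the empty term are translated into a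
harmless repetition of the first line. [Ben-Sasson–Nordström 2009, §2.2 ("the system `R(1)` is
the usual resolution proof system … the cut rule reduces to the familiar resolution rule")]
[cite: BenSassonNordstrom2009, §2.2] -/
theorem exists_resLine_of_isValidResKLine_one {φ : CNF ν} {π : List (ResKLine ν)}
    {π' : List (ResLine ν)} (hlen : π'.length = π.length)
    (hcl : ∀ m (hm : m < π.length) (hm' : m < π'.length), ∅ ∉ (π[m]'hm).dnf →
      (π'[m]'hm').clause = dnfLits (π[m]'hm).dnf)
    (hK : ∀ m (hm : m < π.length), IsKDNF 1 (π[m]'hm).dnf)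
    {l : ResKLine ν} (hl : IsValidResKLine 1 φ π l) :
    ∃ nl : ResLine ν, IsValidResLine φ π' nl ∧ (∅ ∉ l.dnf → nl.clause = dnfLits l.dnf) := by
  obtain ⟨-, hr⟩ := hl
  by_cases he : ∅ ∈ l.dnf
  · -- a line containing the empty term: it cannot be the first line, repeat line `0`
    have h0 : 0 < π'.length := by
      rw [hlen]
      generalize hrl : l.rule = r at hr
      cases r with
      | initial =>
        obtain ⟨C, -, hC⟩ := hr
        exact absurd (hC ▸ he) (empty_notMem_dnfOfClause C)
      | cut i j => obtain ⟨hi, -⟩ := hr; omega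
      | andIntro i j => obtain ⟨hi, -⟩ := hr; omega
      | andElim i => obtain ⟨hi, -⟩ := hr; omega
      | weaken i => obtain ⟨hi, -⟩ := hr; omega
    exact ⟨⟨(π'[0]'h0).clause, .weaken 0⟩, ⟨h0, Finset.Subset.refl _⟩, fun h => absurd he h⟩
  · generalize hrl : l.rule = r at hr
    cases r with
    | initial =>
      obtain ⟨C, hC, hD⟩ := hr
      refine ⟨⟨dnfLits l.dnf, .initial⟩, ?_, fun _ => rfl⟩
      change dnfLits l.dnf ∈ φ.clauseFinsets
      rwa [hD, dnfLits_dnfOfClause]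
    | weaken i =>
      obtain ⟨hi, hsub⟩ := hr
      have hi' : i < π'.length := hlen ▸ hi
      have hei : ∅ ∉ (π[i]'hi).dnf := fun h => he (hsub h)
      refine ⟨⟨dnfLits l.dnf, .weaken i⟩, ⟨hi', ?_⟩, fun _ => rfl⟩
      change (π'[i]'hi').clause ⊆ dnfLits l.dnf
      rw [hcl i hi hi' hei]
      exact dnfLits_mono hsub
    | andElim i =>
      obtain ⟨hi, A, T, T', hT'T, hAi, hD⟩ := hr
      have hi' : i < π'.length := hlen ▸ hi
      have hT'ne : T'.Nonempty := by
        rw [Finset.nonempty_iff_ne_empty]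
        rintro rfl
        exact he (hD ▸ Finset.mem_insert_self _ _)
      have hT1 : T.card ≤ 1 := hK i hi T (hAi ▸ Finset.mem_insert_self _ _)
      have hTT' : T' = T :=
        Finset.eq_of_subset_of_card_le hT'T (hT1.trans (Finset.card_pos.2 hT'ne))
      have hDi : l.dnf = (π[i]'hi).dnf := by rw [hD, hAi, hTT']
      have hei : ∅ ∉ (π[i]'hi).dnf := hDi ▸ he
      refine ⟨⟨dnfLits l.dnf, .weaken i⟩, ⟨hi', ?_⟩, fun _ => rfl⟩
      change (π'[i]'hi').clause ⊆ dnfLits l.dnf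
      rw [hcl i hi hi' hei, hDi]
    | andIntro i j =>
      obtain ⟨hi, hj, A, T, T', hAi, hAj, hD⟩ := hr
      have hi' : i < π'.length := hlen ▸ hi
      have hj' : j < π'.length := hlen ▸ hj
      have hAe : ∅ ∉ A := fun h => he (hD ▸ Finset.mem_insert_of_mem h)
      by_cases hT : T = ∅
      · have hT' : T' ≠ ∅ := by
          rintro rfl
          apply he
          rw [hD, hT, Finset.empty_union]
          exact Finset.mem_insert_self _ _
        have hej : ∅ ∉ (π[j]'hj).dnf := by
          rw [hAj]
          intro h
          rcases Finset.mem_insert.1 h with h | h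
          exacts [hT' h.symm, hAe h]
        refine ⟨⟨dnfLits l.dnf, .weaken j⟩, ⟨hj', ?_⟩, fun _ => rfl⟩
        change (π'[j]'hj').clause ⊆ dnfLits l.dnf
        rw [hcl j hj hj' hej, hAj, hD, dnfLits_insert, dnfLits_insert]
        exact Finset.union_subset_union Finset.subset_union_right (Finset.Subset.refl _)
      · have hei : ∅ ∉ (π[i]'hi).dnf := by
          rw [hAi]
          intro h
          rcases Finset.mem_insert.1 h with h | h
          exacts [hT h.symm, hAe h]
        refine ⟨⟨dnfLits l.dnf, .weaken i⟩, ⟨hi', ?_⟩, fun _ => rfl⟩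
        change (π'[i]'hi').clause ⊆ dnfLits l.dnf
        rw [hcl i hi hi' hei, hAi, hD, dnfLits_insert, dnfLits_insert]
        exact Finset.union_subset_union Finset.subset_union_left (Finset.Subset.refl _)
    | cut i j =>
      obtain ⟨hi, hj, B, C, T, hTne, hBi, hCj, hD⟩ := hr
      have hi' : i < π'.length := hlen ▸ hi
      have hj' : j < π'.length := hlen ▸ hj
      have hT1 : T.card ≤ 1 := hK i hi T (hBi ▸ Finset.mem_insert_self _ _)
      obtain ⟨a, rfl⟩ := Finset.card_eq_one.1 (le_antisymm hT1 (Finset.card_pos.2 hTne))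
      have hBe : ∅ ∉ B := fun h => he (hD ▸ Finset.mem_union_left _ h)
      have hCe : ∅ ∉ C := fun h => he (hD ▸ Finset.mem_union_right _ h)
      have hei : ∅ ∉ (π[i]'hi).dnf := by
        rw [hBi]
        intro h
        rcases Finset.mem_insert.1 h with h | h
        exacts [Finset.singleton_ne_empty a h.symm, hBe h]
      have hej : ∅ ∉ (π[j]'hj).dnf := by
        rw [hCj, negTerm_singleton]
        intro h
        rcases Finset.mem_union.1 h with h | h
        exacts [hCe h, Finset.singleton_ne_empty _ (Finset.mem_singleton.1 h).symm]
      have hci : (π'[i]'hi').clause = insert a (dnfLits B) := by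
        rw [hcl i hi hi' hei, hBi, dnfLits_insert, Finset.insert_eq]
      have hcj : (π'[j]'hj').clause = insert a.negate (dnfLits C) := by
        rw [hcl j hj hj' hej, hCj, negTerm_singleton, dnfLits_union, dnfLits_singleton,
          Finset.union_comm, ← Finset.insert_eq]
      have hK' : dnfLits l.dnf = dnfLits B ∪ dnfLits C := by rw [hD, dnfLits_union]
      by_cases ha : a ∈ dnfLits l.dnf
      · -- the cut literal survives: the conclusion is a weakening of line `i`
        refine ⟨⟨dnfLits l.dnf, .weaken i⟩, ⟨hi', ?_⟩, fun _ => rfl⟩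
        change (π'[i]'hi').clause ⊆ dnfLits l.dnf
        rw [hci]
        exact Finset.insert_subset ha (hK' ▸ Finset.subset_union_left)
      by_cases hna : a.negate ∈ dnfLits l.dnf
      · -- the negated cut literal survives: a weakening of line `j`
        refine ⟨⟨dnfLits l.dnf, .weaken j⟩, ⟨hj', ?_⟩, fun _ => rfl⟩
        change (π'[j]'hj').clause ⊆ dnfLits l.dnf
        rw [hcj]
        exact Finset.insert_subset hna (hK' ▸ Finset.subset_union_right)
      -- a genuine resolution step on the variable of `a`
      have haB : a ∉ dnfLits B := fun h => ha (hK' ▸ Finset.mem_union_left _ h)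
      have hnaC : a.negate ∉ dnfLits C := fun h => hna (hK' ▸ Finset.mem_union_right _ h)
      obtain ⟨v, b⟩ := a
      cases b with
      | true =>
        have hcj' : (π'[j]'hj').clause = insert (v, false) (dnfLits C) := hcj
        have hnaC' : (v, false) ∉ dnfLits C := hnaC
        refine ⟨⟨dnfLits l.dnf, .resolve i j v⟩, ⟨hi', hj', ?_, ?_, ?_⟩, fun _ => rfl⟩
        · rw [hci]; exact Finset.mem_insert_self _ _
        · rw [hcj']; exact Finset.mem_insert_self _ _
        · change dnfLits l.dnf = _
          rw [hci, hcj', Finset.erase_insert haB, Finset.erase_insert hnaC', hK']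
      | false =>
        have hcj' : (π'[j]'hj').clause = insert (v, true) (dnfLits C) := hcj
        have hnaC' : (v, true) ∉ dnfLits C := hnaC
        refine ⟨⟨dnfLits l.dnf, .resolve j i v⟩, ⟨hj', hi', ?_, ?_, ?_⟩, fun _ => rfl⟩
        · rw [hcj']; exact Finset.mem_insert_self _ _
        · rw [hci]; exact Finset.mem_insert_self _ _
        · change dnfLits l.dnf = _
          rw [hci, hcj', Finset.erase_insert haB, Finset.erase_insert hnaC', hK',
            Finset.union_comm]

/-- **`R(1)`-derivations are resolution derivations**: an `R(1)`-derivation from `φ` translates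
into a resolution derivation (`IsResDerivation`, with weakening) from `φ` of the same length in
which every line of the former not containing the empty term has become the clause of its
literals (induction along the derivation with `exists_resLine_of_isValidResKLine_one`).
[Ben-Sasson–Nordström 2009, §2.2 ("the system `R(1)` is the usual resolution proof system");
Krajíček 2001, §1] [cite: BenSassonNordstrom2009, §2.2] -/
theorem IsResKDerivation.exists_isResDerivation_of_one {φ : CNF ν} {π : List (ResKLine ν)}
    (hπ : IsResKDerivation 1 φ π) :
    ∃ π' : List (ResLine ν), π'.length = π.length ∧ IsResDerivation φ π' ∧
      ∀ m (hm : m < π.length) (hm' : m < π'.length), ∅ ∉ (π[m]'hm).dnf →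
        (π'[m]'hm').clause = dnfLits (π[m]'hm).dnf := by
  induction π using List.reverseRecOn with
  | nil => exact ⟨[], rfl, isResDerivation_nil φ, fun m hm => absurd hm (Nat.not_lt_zero m)⟩
  | append_singleton π l ih =>
    have hπ₀ : IsResKDerivation 1 φ π := by
      have := hπ.take π.length
      rwa [List.take_left' rfl] at this
    have hl : IsValidResKLine 1 φ π l := by
      have := hπ π.length (by simp)
      rw [List.take_left' rfl, List.getElem_append_right le_rfl] at this
      simpa using this
    obtain ⟨π', hlen, hder, hcl⟩ := ih hπ₀
    obtain ⟨nl, hnl, hnlc⟩ :=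
      exists_resLine_of_isValidResKLine_one hlen hcl (fun m hm => (hπ₀ m hm).1) hl
    refine ⟨π' ++ [nl], by simp [hlen], hder.append_singleton hnl, fun m hm hm' hme => ?_⟩
    have hm1 : m < π.length + 1 := by simpa using hm
    rcases (Nat.lt_succ_iff.1 hm1).lt_or_eq with hlt | rfl
    · have hlt' : m < π'.length := hlen ▸ hlt
      rw [List.getElem_append_left hlt] at hme ⊢
      rw [List.getElem_append_left hlt']
      exact hcl m hlt hlt' hme
    · rw [List.getElem_append_right le_rfl] at hme ⊢
      rw [List.getElem_append_right hlen.le]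
      simp only [List.getElem_singleton] at hme ⊢
      exact hnlc hme

/-- **`R(1)`-refutations are resolution refutations**, of the same size.
[Ben-Sasson–Nordström 2009, §2.2 ("the system `R(1)` is the usual resolution proof system");
Atserias–Bonet 2004, §2 ("Res(1) is equivalent to Resolution"); Krajíček 2001, §1]
[cite: BenSassonNordstrom2009, §2.2] -/
theorem IsResKRefutation.exists_isResRefutation {φ : CNF ν} {π : List (ResKLine ν)}
    (h : IsResKRefutation 1 φ π) :
    ∃ π' : List (ResLine ν), IsResRefutation φ π' ∧ π'.length = π.length := by
  obtain ⟨hd, l, hl, hle⟩ := h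
  obtain ⟨π', hlen, hder, hcl⟩ := hd.exists_isResDerivation_of_one
  obtain ⟨m, hm, rfl⟩ := List.getElem_of_mem hl
  have hm' : m < π'.length := hlen ▸ hm
  refine ⟨π', ⟨hder, π'[m]'hm', List.getElem_mem hm', ?_⟩, hlen⟩
  rw [hcl m hm hm' (by simp [hle]), hle, dnfLits_empty]

/-- **`R(1)` is resolution, with equal minimal refutation size**: `L_{R(1)}(φ ⊢ 0) = S_R(φ)`.
[Krajíček 2001, §1 ("the size of `R(1)`-proofs is just the size of `R`-proofs");
Ben-Sasson–Nordström 2009, §2.2] [cite: Krajicek2001, §1 (size of R(1)-proofs)] -/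
theorem minResKRefutationSize_one (φ : CNF ν) :
    minResKRefutationSize 1 φ = minResRefutationSize φ := by
  refine le_antisymm (minResKRefutationSize_le_minResRefutationSize le_rfl φ) ?_
  refine le_iInf₂ fun π hπ => ?_
  obtain ⟨π', hπ', hlen⟩ := hπ.exists_isResRefutation
  exact (minResRefutationSize_le_length hπ').trans_eq (by rw [hlen])

end Literature.Computability.MetaComplexity
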